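import Literature.Computability.Complexity.HastadPVCoding
import Literature.Computability.Complexity.Hastad3SatNumbering
import HarnessLib

/-!
# The coding of the block game of a repeated dart game (Håstad machine, the instance)

`HastadPVCoding.lean` reduces the machine rendering of Håstad's E3-CNF to a `Coding` of the underlying
projection game: enumerations of edges and labels, numberings of vertices, and number-theoretic mirrors
of `src`, `dst`, `proj` and of the base points.  This file provides the coding for the game actually
used by the reduction (`Hastad3SatDart`/`Hastad3SatNumbering`): the block game (`BlockSmoothing.block`,
`L = 16k⁵` blocks) of the `T`-fold parallel repetition (`ProjGame.pow`, nested tuples `NProd`) of the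
dart game on the doubled alphabet (`dartGame2`) of a regular constraint graph `(G, C)` given itself by
numeric mirrors `nb` (neighbours) and `C01` (constraints), with the least accepting pair of every dart as
the distinguished admissible labels:

* mixed-radix codes of nested tuples (`codeNP`) and of functions on `Fin L` (`codeFn`), digits and
  digit replacement (`dg`, `updDig`);
* the numeric instance data `NLazy` and the mirrors `src1/dst1/proj1/lab0T` (recursion on `T`),
  `srcM/dstM/projM/xAM/yBM`, assembled as `gM : NumG`;
* the typed side: `accOf` (least accepting pair), the block game `MG`, its closed-form numbering
  `nAM/nBM`, the CNF data `DM = hastadDataN …`, and **`codingM : Coding MG DM gM`**;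
* hence (`HastadPVCoding`) `gM.numCNF ~ hastadCNFN …` (`perm_numCNF_M`) and the numbering is good.

## References

* J. Håstad, *Some optimal inapproximability results*, J. ACM 48 (2001) 798–859, §6.1 [Hastad2001].
* S. Khot, *Hardness results for coloring 3-colorable 3-uniform hypergraphs*, FOCS 2002, §3 (block / smooth
  label cover) [Khot2002].
-/

noncomputable section

namespace Literature.Computability.Complexity

namespace HastadPV

open Literature.Analysis.FunctionSpaces GapPV Finset ProjGame Hastad3Sat LongCode Expander Expander.RotGraph
open Expander.LazyCSP (toNat)

/-! ### Mixed-radix codes -/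

section Codes

variable {X : Type} (cx : X → ℕ) (B : ℕ)

/-- The code of a nested tuple: `⟦(x, r)⟧ = cx x + B ⟦r⟧`, `⟦()⟧ = 0`. [folklore] -/
def codeNP : (t : ℕ) → NProd X t → ℕ
  | 0, _ => 0
  | t + 1, x => cx x.1 + B * codeNP t x.2

/-- The recursion of `codeNP`. [folklore] -/
theorem codeNP_succ (t : ℕ) (x : NProd X (t + 1)) : codeNP cx B (t + 1) x = cx x.1 + B * codeNP cx B t x.2 := rfl

/-- `codeNP` at `0`. [folklore] -/
theorem codeNP_zero (x : NProd X 0) : codeNP cx B 0 x = 0 := rfl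

variable {cx B}

/-- Codes of nested tuples are `< B^t`. [folklore] -/
theorem codeNP_lt (hcx : ∀ x, cx x < B) : ∀ (t : ℕ) (x : NProd X t), codeNP cx B t x < B ^ t
  | 0, _ => by simp [codeNP]
  | t + 1, x => by
    rw [codeNP_succ, pow_succ]
    have := hcx x.1; have := codeNP_lt hcx t x.2; nlinarith

/-- Head and tail of a code. [folklore] -/
theorem codeNP_mod_div (hcx : ∀ x, cx x < B) (t : ℕ) (x : NProd X (t + 1)) :
    codeNP cx B (t + 1) x % B = cx x.1 ∧ codeNP cx B (t + 1) x / B = codeNP cx B t x.2 := by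
  have hB : 0 < B := by have := hcx x.1; omega
  rw [codeNP_succ]
  exact ⟨by rw [Nat.add_mul_mod_self_left, Nat.mod_eq_of_lt (hcx _)], by rw [Nat.add_mul_div_left _ _ hB, Nat.div_eq_of_lt (hcx _), zero_add]⟩

/-- `codeNP` is injective for an injective digit code below the base. [folklore] -/
theorem codeNP_injective (hcx : ∀ x, cx x < B) (hinj : Function.Injective cx) : ∀ t : ℕ, Function.Injective (codeNP cx B t)
  | 0 => fun x y _ => Subsingleton.elim (α := Unit) x y
  | t + 1 => fun x y h => by
    have hx := codeNP_mod_div hcx t x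
    have hy := codeNP_mod_div hcx t y
    rw [h] at hx
    exact Prod.ext (hinj (hx.1.symm.trans hy.1)) (codeNP_injective hcx hinj t (hx.2.symm.trans hy.2))

/-- The code of a constant tuple of digit `0` is `0`. [folklore] -/
theorem codeNP_constNProd {x₀ : X} (h0 : cx x₀ = 0) : ∀ t : ℕ, codeNP cx B t (constNProd x₀ t) = 0
  | 0 => rfl
  | t + 1 => by
    show cx x₀ + B * codeNP cx B t (constNProd x₀ t) = 0
    rw [h0, codeNP_constNProd h0 t, mul_zero]; rfl

/-- `|NProd X t| = |X|^t`. [folklore] -/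
theorem card_NProd (X : Type) [Fintype X] : ∀ t : ℕ, Fintype.card (NProd X t) = Fintype.card X ^ t
  | 0 => by rw [pow_zero, Fintype.card_eq_one_iff]; exact ⟨(), fun y => rfl⟩
  | t + 1 => by
    rw [pow_succ, mul_comm]
    show Fintype.card (X × NProd X t) = _
    rw [Fintype.card_prod, card_NProd X t]

variable (cx B)

/-- The code of a function on `Fin L`: `∑_ℓ cx (w ℓ) B^ℓ`. [folklore] -/
def codeFn {L : ℕ} (w : Fin L → X) : ℕ := ∑ ℓ : Fin L, cx (w ℓ) * B ^ (ℓ : ℕ)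

/-- The recursion of `codeFn` along `Fin.tail`. [folklore] -/
theorem codeFn_succ {L : ℕ} (w : Fin (L + 1) → X) : codeFn cx B w = cx (w 0) + B * codeFn cx B (Fin.tail w) := by
  unfold codeFn
  rw [Fin.sum_univ_succ, Finset.mul_sum]
  simp only [Fin.val_zero, pow_zero, mul_one, Fin.val_succ, pow_succ, Fin.tail]
  congr 1
  exact Finset.sum_congr rfl fun ℓ _ => by ring

variable {cx B}

/-- Codes of functions are `< B^L`. [folklore] -/
theorem codeFn_lt (hcx : ∀ x, cx x < B) : ∀ {L : ℕ} (w : Fin L → X), codeFn cx B w < B ^ L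
  | 0, _ => by simp [codeFn]
  | L + 1, w => by
    rw [codeFn_succ, pow_succ]
    have := hcx (w 0); have := codeFn_lt hcx (Fin.tail w); nlinarith

/-- **The digits of `codeFn`**: `⟦w⟧ / B^ℓ mod B = cx (w ℓ)`. [folklore] -/
theorem codeFn_digit (hcx : ∀ x, cx x < B) : ∀ {L : ℕ} (w : Fin L → X) (ℓ : Fin L), codeFn cx B w / B ^ (ℓ : ℕ) % B = cx (w ℓ)
  | 0, _, ℓ => ℓ.elim0
  | L + 1, w, ℓ => by
    have hB : 0 < B := by have := hcx (w 0); omega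
    rw [codeFn_succ]
    refine Fin.cases ?_ (fun j => ?_) ℓ
    · rw [Fin.val_zero, pow_zero, Nat.div_one, Nat.add_mul_mod_self_left, Nat.mod_eq_of_lt (hcx _)]
    · rw [Fin.val_succ, pow_succ', ← Nat.div_div_eq_div_mul, Nat.add_mul_div_left _ _ hB, Nat.div_eq_of_lt (hcx _), zero_add,
        codeFn_digit hcx (Fin.tail w) j]
      rfl

/-- `codeFn` is injective for an injective digit code below the base. [folklore] -/
theorem codeFn_injective (hcx : ∀ x, cx x < B) (hinj : Function.Injective cx) {L : ℕ} : Function.Injective (codeFn cx B (L := L)) := by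
  intro w w' h
  funext ℓ
  apply hinj
  rw [← codeFn_digit hcx w ℓ, ← codeFn_digit hcx w' ℓ, h]

/-- The code of a constant function. [folklore] -/
theorem codeFn_const {L : ℕ} (x : X) : codeFn cx B (fun _ : Fin L => x) = sumBelow (fun ℓ => cx x * B ^ ℓ) L := by
  unfold codeFn sumBelow
  exact Fin.sum_univ_eq_sum_range (fun ℓ => cx x * B ^ ℓ) L

/-- `codeFn` as a sum over `range L` of a function of the digits. [folklore] -/
theorem codeFn_eq_sumBelow {L : ℕ} (w : Fin L → X) (F : ℕ → ℕ) (hF : ∀ ℓ : Fin L, F ℓ = cx (w ℓ)) :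
    codeFn cx B w = sumBelow (fun ℓ => F ℓ * B ^ ℓ) L := by
  unfold codeFn sumBelow
  rw [← Fin.sum_univ_eq_sum_range]
  exact Finset.sum_congr rfl fun ℓ _ => by rw [hF]

/-! ### Digits and digit replacement -/

/-- Digit `ℓ` in base `B`. [folklore] -/
def dg (B c ℓ : ℕ) : ℕ := c / B ^ ℓ % B

/-- Replacing digit `ℓ` by `x`. [folklore] -/
def updDig (B c ℓ x : ℕ) : ℕ := c - dg B c ℓ * B ^ ℓ + x * B ^ ℓ

/-- The digits of a code. [folklore] -/
theorem dg_codeFn (hcx : ∀ x, cx x < B) {L : ℕ} (w : Fin L → X) (ℓ : Fin L) : dg B (codeFn cx B w) ℓ = cx (w ℓ) :=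
  codeFn_digit hcx w ℓ

/-- **The code of an updated function is the digit replacement.** [folklore] -/
theorem codeFn_update (hcx : ∀ x, cx x < B) {L : ℕ} (w : Fin L → X) (ℓ : Fin L) (x : X) :
    codeFn cx B (Function.update w ℓ x) = updDig B (codeFn cx B w) ℓ (cx x) := by
  unfold updDig
  rw [dg_codeFn hcx]
  have h1 := Finset.add_sum_erase (univ : Finset (Fin L)) (fun ℓ' => cx (w ℓ') * B ^ (ℓ' : ℕ)) (Finset.mem_univ ℓ)
  have h2 := Finset.add_sum_erase (univ : Finset (Fin L)) (fun ℓ' => cx (Function.update w ℓ x ℓ') * B ^ (ℓ' : ℕ)) (Finset.mem_univ ℓ)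
  have h3 : ∑ ℓ' ∈ univ.erase ℓ, cx (Function.update w ℓ x ℓ') * B ^ (ℓ' : ℕ) = ∑ ℓ' ∈ univ.erase ℓ, cx (w ℓ') * B ^ (ℓ' : ℕ) :=
    Finset.sum_congr rfl fun ℓ' h => by rw [Function.update_of_ne (Finset.ne_of_mem_erase h)]
  simp only [Function.update_self] at h2
  unfold codeFn
  rw [← h1, ← h2, h3]
  omega

end Codes

/-! ### The numeric instance and the numeric mirrors -/

/-- The numeric data of a lazy regular constraint graph: sizes `n`, `d`, alphabet `W`, the neighbour
function and the `0/1` constraints. [folklore] -/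
structure NLazy where
  /-- number of vertices -/
  n : ℕ
  /-- degree -/
  d : ℕ
  /-- alphabet size -/
  W : ℕ
  /-- neighbour of dart `(v, i)` -/
  nb : ℕ → ℕ → ℕ
  /-- the constraint of dart `(v, i)` on `(a, b)`, as `0/1` -/
  C01 : ℕ → ℕ → ℕ → ℕ → ℕ

namespace NLazy

variable (Z : NLazy)

/-- The doubled alphabet size `2W`. [folklore] -/
def W2 : ℕ := 2 * Z.W

/-- The number of darts `n d`. [folklore] -/
def ND : ℕ := Z.n * Z.d

/-- The number of label codes of the dart game `(2W)²`. [folklore] -/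
def NB0 : ℕ := Z.W2 * Z.W2

/-- **The least accepting pair** of dart `(v, i)`, as the code `a W + b`. [folklore] -/
def accP (v i : ℕ) : ℕ := muNat (fun p => Z.C01 v i (p / Z.W) (p % Z.W)) (Z.W * Z.W)

/-- The code `(2a) · 2W + 2b` of the first distinguished label of the dart with code `dc`. [cite: Hastad2001, §6.1] -/
def l0 (dc : ℕ) : ℕ := 2 * (Z.accP (dc / Z.d) (dc % Z.d) / Z.W) * Z.W2 + 2 * (Z.accP (dc / Z.d) (dc % Z.d) % Z.W)

/-- Alice's endpoint of the dart-game edge with code `x = 2 · dart + s`. [cite: AroraBarakCC2009, Claim 22.36] -/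
def dartEndN (x : ℕ) : ℕ := if x % 2 = 0 then x / 2 / Z.d else Z.nb (x / 2 / Z.d) (x / 2 % Z.d)

/-- The projection of the dart-game edge `x` on the label code `yb` (`0` = rejected, `a + 1` = accepted).
[cite: AroraBarakCC2009, Claim 22.36] -/
def dartProjN (x yb : ℕ) : ℕ :=
  if Z.C01 (x / 2 / Z.d) (x / 2 % Z.d) (yb / Z.W2 / 2) (yb % Z.W2 / 2) = 1 then (if x % 2 = 0 then yb / Z.W2 else yb % Z.W2) + 1 else 0

/-- Bob's vertex of an edge code of the `T`-fold repetition. [cite: DinurSteurer2014, §2.2] -/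
def src1 : ℕ → ℕ → ℕ
  | 0, _ => 0
  | t + 1, c => c % (2 * Z.ND) / 2 + Z.ND * src1 t (c / (2 * Z.ND))

/-- Alice's vertex of an edge code of the `T`-fold repetition. [cite: DinurSteurer2014, §2.2] -/
def dst1 : ℕ → ℕ → ℕ
  | 0, _ => 0
  | t + 1, c => Z.dartEndN (c % (2 * Z.ND)) + Z.n * dst1 t (c / (2 * Z.ND))

/-- The projection of the `T`-fold repetition (`0` = rejected, `a + 1` = accepted). [cite: DinurSteurer2014, §2.2] -/
def proj1 : ℕ → ℕ → ℕ → ℕ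
  | 0, _, _ => 1
  | t + 1, c, y =>
    if Z.dartProjN (c % (2 * Z.ND)) (y % Z.NB0) = 0 then 0
    else if proj1 t (c / (2 * Z.ND)) (y / Z.NB0) = 0 then 0
    else Z.dartProjN (c % (2 * Z.ND)) (y % Z.NB0) - 1 + Z.W2 * (proj1 t (c / (2 * Z.ND)) (y / Z.NB0) - 1) + 1

/-- The code of the tuple of first distinguished labels along a Bob vertex code of the repetition. [cite: Hastad2001, §6.1] -/
def lab0T : ℕ → ℕ → ℕ
  | 0, _ => 0
  | t + 1, c => Z.l0 (c % Z.ND) + Z.NB0 * lab0T t (c / Z.ND)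

variable (T L : ℕ)

/-- Bob vertex codes of the repetition. [folklore] -/
def NV1 : ℕ := Z.ND ^ T
/-- Edge codes of the repetition. [folklore] -/
def NE1 : ℕ := (2 * Z.ND) ^ T
/-- Alice vertex codes of the repetition. [folklore] -/
def NU1 : ℕ := Z.n ^ T
/-- Bob label codes of the repetition. [folklore] -/
def NB1 : ℕ := Z.NB0 ^ T
/-- Alice label codes of the repetition. [folklore] -/
def NA1 : ℕ := Z.W2 ^ T
/-- Bob vertex codes of the block game. [folklore] -/
def NVM : ℕ := Z.NV1 T ^ L
/-- Edge codes of the block game. [folklore] -/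
def NEM : ℕ := L * (Z.NVM T L * Z.NE1 T)
/-- A bound on Alice vertex codes of the block game. [folklore] -/
def NUM : ℕ := L * (Z.NVM T L * Z.NU1 T)
/-- Bob label codes of the block game. [folklore] -/
def NBM : ℕ := Z.NB1 T ^ L
/-- Alice label codes of the block game. [folklore] -/
def NAM : ℕ := Z.NBM T L * Z.NA1 T

/-- The code of the blank label `b₀`. [folklore] -/
def b0 : ℕ := Z.lab0T T 0

/-- **Bob's vertex of a block-game edge code** `ℓ + L (vs + NVM · e)`: `vs` with digit `ℓ` replaced by `src e`.
[cite: Khot2002, §3] -/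
def srcM (c : ℕ) : ℕ := updDig (Z.NV1 T) (c / L % Z.NVM T L) (c % L) (Z.src1 T (c / L / Z.NVM T L))

/-- **Alice's vertex of a block-game edge code.** [cite: Khot2002, §3] -/
def dstM (c : ℕ) : ℕ := c % L + L * (updDig (Z.NV1 T) (c / L % Z.NVM T L) (c % L) 0 + Z.NVM T L * Z.dst1 T (c / L / Z.NVM T L))

/-- **The projection of a block-game edge code on a label code** (`0` = rejected, `a + 1` = accepted).
[cite: Khot2002, §3] -/
def projM (c y : ℕ) : ℕ :=
  if Z.proj1 T (c / L / Z.NVM T L) (dg (Z.NB1 T) y (c % L)) = 0 then 0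
  else updDig (Z.NB1 T) y (c % L) (Z.b0 T) + Z.NBM T L * (Z.proj1 T (c / L / Z.NVM T L) (dg (Z.NB1 T) y (c % L)) - 1) + 1

/-- The code of Alice's base label (the same at every vertex). [folklore] -/
def xAM (_u : ℕ) : ℕ := sumBelow (fun ℓ => Z.b0 T * Z.NB1 T ^ ℓ) L

/-- The code of Bob's base label at the vertex code `w`: blockwise distinguished labels. [folklore] -/
def yBM (w : ℕ) : ℕ := sumBelow (fun ℓ => Z.lab0T T (dg (Z.NV1 T) w ℓ) * Z.NB1 T ^ ℓ) L

/-- **The numeric data of the block game** at precision `k`. [cite: Hastad2001, §6.1] -/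
def gM (k : ℕ) : NumG where
  NE := Z.NEM T L
  NB := Z.NBM T L
  NA := Z.NAM T L
  NU := Z.NUM T L
  p := 1
  q := k
  Kst := Z.NBM T L
  srcN := Z.srcM T L
  dstN := Z.dstM T L
  projN := Z.projM T L
  xAN := Z.xAM T L
  yBN := Z.yBM T L

end NLazy

/-! ### The typed side: the least accepting pairs -/

section Typed

variable (Z : NLazy) (G : RotGraph Z.n Z.d) (C : Fin Z.n → Fin Z.d → ℕ → ℕ → Bool)

/-- The least accepting pair of a dart, as the code `a W + b`. [folklore] -/
def accP' (v : Fin Z.n) (i : Fin Z.d) : ℕ := muNat (fun p => (C v i (p / Z.W) (p % Z.W)).toNat) (Z.W * Z.W)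

/-- **The least accepting pair of a dart.** [folklore] -/
def accOf (v : Fin Z.n) (i : Fin Z.d) : ℕ × ℕ := (accP' Z C v i / Z.W, accP' Z C v i % Z.W)

variable {Z G C}

/-- If some pair below `W` is accepted, the search succeeds. [folklore] -/
theorem accP'_lt_of_exists {v : Fin Z.n} {i : Fin Z.d} (h : ∃ p : ℕ × ℕ, p.1 < Z.W ∧ p.2 < Z.W ∧ C v i p.1 p.2 = true) :
    accP' Z C v i < Z.W * Z.W := by
  obtain ⟨p, hp1, hp2, hC⟩ := h
  have hW : 0 < Z.W := by omega
  unfold accP'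
  by_contra hge
  have heq : muNat (fun p => (C v i (p / Z.W) (p % Z.W)).toNat) (Z.W * Z.W) = Z.W * Z.W := le_antisymm (muNat_le _ _) (not_lt.1 hge)
  have hcode : p.1 * Z.W + p.2 < Z.W * Z.W := by nlinarith
  have h0 := eq_zero_of_lt_muNat (P := fun p => (C v i (p / Z.W) (p % Z.W)).toNat) (k := Z.W * Z.W) (i := p.1 * Z.W + p.2) (by rw [heq]; exact hcode)
  have hd : (p.1 * Z.W + p.2) / Z.W = p.1 := by rw [show p.1 * Z.W + p.2 = p.2 + Z.W * p.1 by ring, Nat.add_mul_div_left _ _ hW, Nat.div_eq_of_lt hp2, zero_add]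
  have hm : (p.1 * Z.W + p.2) % Z.W = p.2 := by rw [show p.1 * Z.W + p.2 = p.2 + Z.W * p.1 by ring, Nat.add_mul_mod_self_left, Nat.mod_eq_of_lt hp2]
  simp only [hd, hm, hC] at h0
  exact absurd h0 (by simp)

/-- If the search succeeds, the least accepting pair is an accepting pair below `W`. [folklore] -/
theorem accOf_spec_of_lt {v : Fin Z.n} {i : Fin Z.d} (hlt : accP' Z C v i < Z.W * Z.W) :
    (accOf Z C v i).1 < Z.W ∧ (accOf Z C v i).2 < Z.W ∧ C v i (accOf Z C v i).1 (accOf Z C v i).2 = true := by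
  have hW : 0 < Z.W := by
    rcases Nat.eq_zero_or_pos Z.W with h0 | h0
    · rw [h0] at hlt; simp at hlt
    · exact h0
  have hne := ne_zero_muNat hlt
  unfold accOf
  refine ⟨Nat.div_lt_of_lt_mul hlt, Nat.mod_lt _ hW, ?_⟩
  unfold accP' at hne ⊢
  simp only [ne_eq, Bool.toNat_eq_zero, Bool.not_eq_false] at hne
  exact hne

/-- **The search succeeds iff some pair below `W` is accepted.** [folklore] -/
theorem accP'_lt_iff (v : Fin Z.n) (i : Fin Z.d) : accP' Z C v i < Z.W * Z.W ↔ ∃ p : ℕ × ℕ, p.1 < Z.W ∧ p.2 < Z.W ∧ C v i p.1 p.2 = true :=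
  ⟨fun h => ⟨accOf Z C v i, accOf_spec_of_lt h⟩, accP'_lt_of_exists⟩

/-- The least accepting pair is an accepting pair below `W`. [folklore] -/
theorem accOf_spec (hall : ∀ v i, ∃ p : ℕ × ℕ, p.1 < Z.W ∧ p.2 < Z.W ∧ C v i p.1 p.2 = true) (v : Fin Z.n) (i : Fin Z.d) :
    (accOf Z C v i).1 < Z.W ∧ (accOf Z C v i).2 < Z.W ∧ C v i (accOf Z C v i).1 (accOf Z C v i).2 = true :=
  accOf_spec_of_lt (accP'_lt_of_exists (hall v i))

/-- The mirror hypotheses: `nb` is the neighbour function and `C01` the `0/1` form of `C`. [folklore] -/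
structure Mirror (G : RotGraph Z.n Z.d) (C : Fin Z.n → Fin Z.d → ℕ → ℕ → Bool) : Prop where
  /-- neighbours -/
  nb_eq : ∀ (v : Fin Z.n) (i : Fin Z.d), Z.nb v i = (G.nbr v i).val
  /-- constraints -/
  C_eq : ∀ (v : Fin Z.n) (i : Fin Z.d) (a b : ℕ), Z.C01 v i a b = (C v i a b).toNat

/-- `accP` mirrors `accP'`. [folklore] -/
theorem accP_eq (hM : Mirror (Z := Z) G C) (v : Fin Z.n) (i : Fin Z.d) : Z.accP v i = accP' Z C v i := by
  unfold NLazy.accP accP' muNat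
  exact loopNat_congr fun p _ acc => by simp only [hM.C_eq]

/-! ### The typed side: codes of darts, edges and labels -/

variable (Z)

/-- The code `v d + i` of a dart. [folklore] -/
def cdart (δ : Fin Z.n × Fin Z.d) : ℕ := δ.1.val * Z.d + δ.2.val

/-- The code `2 · dart + s` of a dart-game edge. [folklore] -/
def ce0 (e : (Fin Z.n × Fin Z.d) × Fin 2) : ℕ := 2 * cdart Z e.1 + e.2.val

/-- The code `a · 2W + b` of a dart-game label of Bob. [folklore] -/
def cb0 (b : Fin (2 * Z.W) × Fin (2 * Z.W)) : ℕ := b.1.val * Z.W2 + b.2.val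

variable (T : ℕ)

/-- Codes of Bob's vertices of the repetition. [folklore] -/
def cV1 : NProd (Fin Z.n × Fin Z.d) T → ℕ := codeNP (cdart Z) Z.ND T
/-- Codes of edges of the repetition. [folklore] -/
def cE1 : NProd ((Fin Z.n × Fin Z.d) × Fin 2) T → ℕ := codeNP (ce0 Z) (2 * Z.ND) T
/-- Codes of Alice's vertices of the repetition. [folklore] -/
def cU1 : NProd (Fin Z.n) T → ℕ := codeNP (fun v : Fin Z.n => v.val) Z.n T
/-- Codes of Bob's labels of the repetition. [folklore] -/
def cB1 : NProd (Fin (2 * Z.W) × Fin (2 * Z.W)) T → ℕ := codeNP (cb0 Z) Z.NB0 T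
/-- Codes of Alice's labels of the repetition. [folklore] -/
def cA1 : NProd (Fin (2 * Z.W)) T → ℕ := codeNP (fun a : Fin (2 * Z.W) => a.val) Z.W2 T

variable {Z T}

/-- Dart codes are `< n d` and the code is injective. [folklore] -/
theorem cdart_lt (δ : Fin Z.n × Fin Z.d) : cdart Z δ < Z.ND := by
  unfold cdart NLazy.ND; have := δ.1.2; have := δ.2.2; nlinarith

/-- Decoding a dart code. [folklore] -/
theorem cdart_div_mod (δ : Fin Z.n × Fin Z.d) : cdart Z δ / Z.d = δ.1.val ∧ cdart Z δ % Z.d = δ.2.val := by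
  unfold cdart
  have hd : 0 < Z.d := by have := δ.2.2; omega
  exact ⟨by rw [show δ.1.val * Z.d + δ.2.val = δ.2.val + Z.d * δ.1.val by ring, Nat.add_mul_div_left _ _ hd, Nat.div_eq_of_lt δ.2.2, zero_add],
    by rw [show δ.1.val * Z.d + δ.2.val = δ.2.val + Z.d * δ.1.val by ring, Nat.add_mul_mod_self_left, Nat.mod_eq_of_lt δ.2.2]⟩

/-- `cdart` is injective. [folklore] -/
theorem cdart_injective : Function.Injective (cdart Z) := fun δ δ' h => by
  have h1 := cdart_div_mod δ; have h2 := cdart_div_mod δ'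
  rw [h] at h1
  exact Prod.ext (Fin.ext (h1.1.symm.trans h2.1)) (Fin.ext (h1.2.symm.trans h2.2))

/-- Edge codes are `< 2 n d`. [folklore] -/
theorem ce0_lt (e : (Fin Z.n × Fin Z.d) × Fin 2) : ce0 Z e < 2 * Z.ND := by
  unfold ce0; have := cdart_lt e.1; have := e.2.2; omega

/-- Decoding an edge code. [folklore] -/
theorem ce0_div_mod (e : (Fin Z.n × Fin Z.d) × Fin 2) : ce0 Z e / 2 = cdart Z e.1 ∧ ce0 Z e % 2 = e.2.val := by
  unfold ce0; have := e.2.2; constructor <;> omega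

/-- `ce0` is injective. [folklore] -/
theorem ce0_injective : Function.Injective (ce0 Z) := fun e e' h => by
  have h1 := ce0_div_mod e; have h2 := ce0_div_mod e'
  rw [h] at h1
  exact Prod.ext (cdart_injective (h1.1.symm.trans h2.1)) (Fin.ext (h1.2.symm.trans h2.2))

/-- Label codes are `< (2W)²`. [folklore] -/
theorem cb0_lt (b : Fin (2 * Z.W) × Fin (2 * Z.W)) : cb0 Z b < Z.NB0 := by
  unfold cb0 NLazy.NB0 NLazy.W2; have := b.1.2; have := b.2.2; nlinarith

/-- Decoding a label code. [folklore] -/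
theorem cb0_div_mod (b : Fin (2 * Z.W) × Fin (2 * Z.W)) : cb0 Z b / Z.W2 = b.1.val ∧ cb0 Z b % Z.W2 = b.2.val := by
  unfold cb0
  have h2 : b.2.val < Z.W2 := b.2.2
  have hW : 0 < Z.W2 := by omega
  exact ⟨by rw [show b.1.val * Z.W2 + b.2.val = b.2.val + Z.W2 * b.1.val by ring, Nat.add_mul_div_left _ _ hW, Nat.div_eq_of_lt h2, zero_add],
    by rw [show b.1.val * Z.W2 + b.2.val = b.2.val + Z.W2 * b.1.val by ring, Nat.add_mul_mod_self_left, Nat.mod_eq_of_lt h2]⟩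

/-- `cb0` is injective. [folklore] -/
theorem cb0_injective : Function.Injective (cb0 Z) := fun b b' h => by
  have h1 := cb0_div_mod b; have h2 := cb0_div_mod b'
  rw [h] at h1
  exact Prod.ext (Fin.ext (h1.1.symm.trans h2.1)) (Fin.ext (h1.2.symm.trans h2.2))

/-! ### The mirrors of the repetition -/

section Pow

variable (hd : 0 < Z.d) (hM : Mirror (Z := Z) G C)

/-- `src1` mirrors `src` of the repetition. [cite: DinurSteurer2014, §2.2] -/
theorem src1_eq : ∀ (T : ℕ) (e : NProd ((Fin Z.n × Fin Z.d) × Fin 2) T), Z.src1 T (cE1 Z T e) = cV1 Z T (((G.dartGame2 C Z.W hd).pow T).src e)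
  | 0, _ => rfl
  | T + 1, e => by
    have hmd : cE1 Z (T + 1) e % (2 * Z.ND) = ce0 Z e.1 ∧ cE1 Z (T + 1) e / (2 * Z.ND) = cE1 Z T e.2 := codeNP_mod_div ce0_lt T e
    rw [NLazy.src1, hmd.1, hmd.2, src1_eq T e.2, (ce0_div_mod e.1).1]
    rfl

include hM in
/-- `dartEndN` mirrors `dartEnd`. [cite: AroraBarakCC2009, Claim 22.36] -/
theorem dartEndN_eq (e : (Fin Z.n × Fin Z.d) × Fin 2) : Z.dartEndN (ce0 Z e) = (G.dartEnd e).val := by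
  unfold NLazy.dartEndN RotGraph.dartEnd
  rw [(ce0_div_mod e).1, (ce0_div_mod e).2, (cdart_div_mod e.1).1, (cdart_div_mod e.1).2]
  by_cases h : e.2 = 0
  · rw [if_pos (show e.2.val = 0 by rw [h]; rfl), if_pos h]
  · rw [if_neg (show ¬ e.2.val = 0 from fun h0 => h (Fin.ext h0)), if_neg h, hM.nb_eq]

include hM in
/-- `dst1` mirrors `dst` of the repetition. [cite: DinurSteurer2014, §2.2] -/
theorem dst1_eq : ∀ (T : ℕ) (e : NProd ((Fin Z.n × Fin Z.d) × Fin 2) T), Z.dst1 T (cE1 Z T e) = cU1 Z T (((G.dartGame2 C Z.W hd).pow T).dst e)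
  | 0, _ => rfl
  | T + 1, e => by
    have hmd : cE1 Z (T + 1) e % (2 * Z.ND) = ce0 Z e.1 ∧ cE1 Z (T + 1) e / (2 * Z.ND) = cE1 Z T e.2 := codeNP_mod_div ce0_lt T e
    rw [NLazy.dst1, hmd.1, hmd.2, dst1_eq T e.2, dartEndN_eq hM]
    rfl

include hM in
/-- `dartProjN` mirrors `dartProj` on the doubled alphabet. [cite: AroraBarakCC2009, Claim 22.36] -/
theorem dartProjN_eq (e : (Fin Z.n × Fin Z.d) × Fin 2) (b : Fin (2 * Z.W) × Fin (2 * Z.W)) :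
    Z.dartProjN (ce0 Z e) (cb0 Z b) =
      (dartProj (dbl C) (2 * Z.W) (fun (_ : Fin Z.n × Fin Z.d) (p : Fin (2 * Z.W) × Fin (2 * Z.W)) => p) e b).elim 0 fun a => a.val + 1 := by
  unfold NLazy.dartProjN dartProj dbl
  rw [(ce0_div_mod e).1, (ce0_div_mod e).2, (cdart_div_mod e.1).1, (cdart_div_mod e.1).2, (cb0_div_mod b).1, (cb0_div_mod b).2, hM.C_eq]
  cases C e.1.1 e.1.2 (b.1.val / 2) (b.2.val / 2)
  · simp
  · by_cases h : e.2 = 0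
    · simp [h]
    · have h' : e.2.val ≠ 0 := fun h0 => h (Fin.ext h0)
      simp [h, h']

include hM in
/-- `proj1` mirrors `proj` of the repetition. [cite: DinurSteurer2014, §2.2] -/
theorem proj1_eq : ∀ (T : ℕ) (e : NProd ((Fin Z.n × Fin Z.d) × Fin 2) T) (b : NProd (Fin (2 * Z.W) × Fin (2 * Z.W)) T),
    Z.proj1 T (cE1 Z T e) (cB1 Z T b) = (((G.dartGame2 C Z.W hd).pow T).proj e b).elim 0 fun a => cA1 Z T a + 1
  | 0, _, _ => rfl
  | T + 1, e, b => by
    have hme : cE1 Z (T + 1) e % (2 * Z.ND) = ce0 Z e.1 ∧ cE1 Z (T + 1) e / (2 * Z.ND) = cE1 Z T e.2 := codeNP_mod_div ce0_lt T e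
    have hmb : cB1 Z (T + 1) b % Z.NB0 = cb0 Z b.1 ∧ cB1 Z (T + 1) b / Z.NB0 = cB1 Z T b.2 := codeNP_mod_div cb0_lt T b
    rw [NLazy.proj1, hme.1, hme.2, hmb.1, hmb.2, proj1_eq T e.2 b.2, dartProjN_eq hM]
    show _ = (prodProj ((G.dartGame2 C Z.W hd).proj e.1) (((G.dartGame2 C Z.W hd).pow T).proj e.2) b).elim 0 fun a => cA1 Z (T + 1) a + 1
    unfold prodProj
    rw [dartGame_proj]
    cases dartProj (dbl C) (2 * Z.W) (fun (_ : Fin Z.n × Fin Z.d) (p : Fin (2 * Z.W) × Fin (2 * Z.W)) => p) e.1 b.1 with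
    | none => rfl
    | some a =>
      have e1 : ((some a).elim 0 fun a : Fin (2 * Z.W) => a.val + 1) = a.val + 1 := rfl
      rw [e1, if_neg (Nat.succ_ne_zero _)]
      cases ((G.dartGame2 C Z.W hd).pow T).proj e.2 b.2 with
      | none =>
        have e2 : ((none : Option (NProd (Fin (2 * Z.W)) T)).elim 0 fun a => cA1 Z T a + 1) = 0 := rfl
        rw [e2, if_pos rfl]; rfl
      | some a' =>
        have e2 : ((some a').elim 0 fun a => cA1 Z T a + 1) = cA1 Z T a' + 1 := rfl
        rw [e2, if_neg (Nat.succ_ne_zero _), Nat.add_sub_cancel, Nat.add_sub_cancel]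
        rfl

variable (hall : ∀ v i, ∃ p : ℕ × ℕ, p.1 < Z.W ∧ p.2 < Z.W ∧ C v i p.1 p.2 = true)

include hM in
/-- `l0` mirrors the first distinguished label. [cite: Hastad2001, §6.1] -/
theorem l0_eq (δ : Fin Z.n × Fin Z.d) : Z.l0 (cdart Z δ) = cb0 Z (lab0Fun C Z.W (accOf Z C) (accOf_spec hall) δ) := by
  unfold NLazy.l0 lab0Fun cb0 accOf
  rw [(cdart_div_mod δ).1, (cdart_div_mod δ).2, accP_eq hM]

include hM in
/-- `lab0T` mirrors the tuple of first distinguished labels. [cite: Hastad2001, §6.1] -/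
theorem lab0T_eq : ∀ (T : ℕ) (v : NProd (Fin Z.n × Fin Z.d) T),
    Z.lab0T T (cV1 Z T v) = cB1 Z T (tupleNProd (lab0Fun C Z.W (accOf Z C) (accOf_spec hall)) T v)
  | 0, _ => rfl
  | T + 1, v => by
    have hmd : cV1 Z (T + 1) v % Z.ND = cdart Z v.1 ∧ cV1 Z (T + 1) v / Z.ND = cV1 Z T v.2 := codeNP_mod_div cdart_lt T v
    rw [NLazy.lab0T, hmd.1, hmd.2, lab0T_eq T v.2, l0_eq hM hall]
    rfl

end Pow

/-! ### Mixed-radix pairs and triples -/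

/-- A mixed pair `ℓ + L · X` is below `L · Y` when `ℓ < L`, `X < Y`. [folklore] -/
theorem add_mul_lt {ℓ L X Y : ℕ} (hℓ : ℓ < L) (hX : X < Y) : ℓ + L * X < L * Y := by nlinarith

/-- A mixed pair `a + A · b` is below `A · B` when `a < A`, `b < B`. [folklore] -/
theorem add_mul_lt' {a A b B : ℕ} (ha : a < A) (hb : b < B) : a + A * b < A * B := by nlinarith

/-- Decoding a mixed triple `ℓ + L (a + A b)`. [folklore] -/
theorem decode3 {ℓ L a A b : ℕ} (hℓ : ℓ < L) (ha : a < A) :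
    (ℓ + L * (a + A * b)) % L = ℓ ∧ (ℓ + L * (a + A * b)) / L % A = a ∧ (ℓ + L * (a + A * b)) / L / A = b := by
  have hL : 0 < L := by omega
  have hA : 0 < A := by omega
  have h1 : (ℓ + L * (a + A * b)) / L = a + A * b := by rw [Nat.add_mul_div_left _ _ hL, Nat.div_eq_of_lt hℓ, zero_add]
  refine ⟨by rw [Nat.add_mul_mod_self_left, Nat.mod_eq_of_lt hℓ], by rw [h1, Nat.add_mul_mod_self_left, Nat.mod_eq_of_lt ha],
    by rw [h1, Nat.add_mul_div_left _ _ hA, Nat.div_eq_of_lt ha, zero_add]⟩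

/-! ### Bounds on the mirrors (for the size of the output) -/

section Bounds

/-- Digits of the repetition are darts: `src1 T c < NV1`. [folklore] -/
theorem src1_lt (hd : 0 < Z.ND) : ∀ (T c : ℕ), Z.src1 T c < Z.NV1 T
  | 0, _ => by simp [NLazy.src1, NLazy.NV1]
  | T + 1, c => by
    rw [NLazy.src1]; unfold NLazy.NV1; rw [pow_succ]
    have h1 : c % (2 * Z.ND) / 2 < Z.ND := Nat.div_lt_of_lt_mul (by have := Nat.mod_lt c (show 0 < 2 * Z.ND by omega); linarith)
    have h2 := src1_lt hd T (c / (2 * Z.ND))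
    unfold NLazy.NV1 at h2
    nlinarith

/-- Under the mirror hypotheses neighbours are vertices: `dartEndN x < n` for `x < 2 n d`. [folklore] -/
theorem dartEndN_lt (hM : Mirror (Z := Z) G C) {x : ℕ} (hx : x < 2 * Z.ND) : Z.dartEndN x < Z.n := by
  have hnd : x / 2 < Z.n * Z.d := Nat.div_lt_of_lt_mul (by unfold NLazy.ND at hx; linarith)
  have hd : 0 < Z.d := by
    rcases Nat.eq_zero_or_pos Z.d with h0 | h0
    · rw [h0, mul_zero] at hnd; simp at hnd
    · exact h0
  have hv : x / 2 / Z.d < Z.n := Nat.div_lt_of_lt_mul (by rwa [mul_comm] at hnd)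
  have hi : x / 2 % Z.d < Z.d := Nat.mod_lt _ hd
  unfold NLazy.dartEndN
  split_ifs
  · exact hv
  · rw [hM.nb_eq ⟨_, hv⟩ ⟨_, hi⟩]; exact (G.nbr _ _).2

/-- `dst1 T c < NU1` under the mirror hypotheses. [folklore] -/
theorem dst1_lt (hM : Mirror (Z := Z) G C) (hd : 0 < Z.ND) : ∀ (T c : ℕ), Z.dst1 T c < Z.NU1 T
  | 0, _ => by simp [NLazy.dst1, NLazy.NU1]
  | T + 1, c => by
    rw [NLazy.dst1]; unfold NLazy.NU1; rw [pow_succ]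
    have h1 : Z.dartEndN (c % (2 * Z.ND)) < Z.n := dartEndN_lt hM (Nat.mod_lt _ (by omega))
    have h2 := dst1_lt hM hd T (c / (2 * Z.ND))
    unfold NLazy.NU1 at h2
    nlinarith

/-- Digit replacement keeps codes below `B^L`. [folklore] -/
theorem updDig_lt {B X L ℓ x : ℕ} (hX : X < B ^ L) (hℓ : ℓ < L) (hx : x < B) : updDig B X ℓ x < B ^ L := by
  have hB : 0 < B := by omega
  unfold updDig dg
  set q := X / B ^ (ℓ + 1) with hq
  set r := X % B ^ ℓ with hr
  -- `X = q B^{ℓ+1} + dg B^ℓ + r`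
  have hXeq : X = q * B ^ (ℓ + 1) + X / B ^ ℓ % B * B ^ ℓ + r := by
    have e1 := (Nat.div_add_mod X (B ^ ℓ)).symm
    have e2 := (Nat.div_add_mod (X / B ^ ℓ) B).symm
    rw [Nat.div_div_eq_div_mul, ← pow_succ] at e2
    calc X = B ^ ℓ * (X / B ^ ℓ) + X % B ^ ℓ := e1
      _ = B ^ ℓ * (B * (X / B ^ (ℓ + 1)) + X / B ^ ℓ % B) + X % B ^ ℓ := by rw [← e2]
      _ = _ := by rw [hq, hr, pow_succ]; ring
  have hrlt : r < B ^ ℓ := Nat.mod_lt _ (pow_pos hB _)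
  have hqlt : q < B ^ (L - (ℓ + 1)) := by
    rw [hq]
    exact Nat.div_lt_of_lt_mul (by rw [← pow_add, show ℓ + 1 + (L - (ℓ + 1)) = L by omega]; exact hX)
  have h1 : x * B ^ ℓ + r < B ^ (ℓ + 1) := by
    rw [pow_succ]; nlinarith [Nat.mul_le_mul_right (B ^ ℓ) (Nat.succ_le_of_lt hx), hrlt]
  have h2 : (q + 1) * B ^ (ℓ + 1) ≤ B ^ L := by
    calc (q + 1) * B ^ (ℓ + 1) ≤ B ^ (L - (ℓ + 1)) * B ^ (ℓ + 1) := Nat.mul_le_mul_right _ hqlt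
      _ = B ^ L := by rw [← pow_add, show L - (ℓ + 1) + (ℓ + 1) = L by omega]
  have key : q * B ^ (ℓ + 1) + x * B ^ ℓ + r < B ^ L := by nlinarith
  have hsub : X - X / B ^ ℓ % B * B ^ ℓ = q * B ^ (ℓ + 1) + r := Nat.sub_eq_of_eq_add (by linarith [hXeq])
  rw [hsub]
  linarith

variable (T L : ℕ)

/-- `srcM c < NVM` (when `L ≥ 1`, `n d ≥ 1`). [folklore] -/
theorem srcM_lt (hd : 0 < Z.ND) (hL : 0 < L) (c : ℕ) : Z.srcM T L c < Z.NVM T L := by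
  unfold NLazy.srcM NLazy.NVM
  exact updDig_lt (Nat.mod_lt _ (pow_pos (pow_pos hd _) _)) (Nat.mod_lt _ hL) (src1_lt hd T _)

/-- `dstM c < NUM` under the mirror hypotheses (when `L ≥ 1`, `n d ≥ 1`). [folklore] -/
theorem dstM_lt (hM : Mirror (Z := Z) G C) (hd : 0 < Z.ND) (hL : 0 < L) (c : ℕ) : Z.dstM T L c < Z.NUM T L := by
  unfold NLazy.dstM NLazy.NUM
  have h1 : c % L < L := Nat.mod_lt _ hL
  have hB : 0 < Z.NV1 T := pow_pos hd _
  have h2 : updDig (Z.NV1 T) (c / L % Z.NVM T L) (c % L) 0 < Z.NVM T L := by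
    unfold NLazy.NVM; exact updDig_lt (Nat.mod_lt _ (pow_pos hB _)) h1 hB
  have h3 := dst1_lt hM hd T (c / L / Z.NVM T L)
  exact add_mul_lt h1 (add_mul_lt' h2 h3)

end Bounds

/-! ### The typed side: the block game and its codes -/

section Block

variable (Z G C)
variable (hd : 0 < Z.d) (hn : 0 < Z.n) (hall : ∀ v i, ∃ p : ℕ × ℕ, p.1 < Z.W ∧ p.2 < Z.W ∧ C v i p.1 p.2 = true)
  (T : ℕ) (hT : 0 < T) (k : ℕ) (hk : 0 < k)

/-- The hypotheses of the assembly for the repeated dart game, with the least accepting pairs.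
[cite: Hastad2001, §6.1] -/
abbrev hypM : HastadHyp ((G.dartGame2 C Z.W hd).pow T) := G.dartHyp C Z.W hd (accOf Z C) (accOf_spec hall) hn T hT

/-- **The block game of the repeated dart game** (the game of `hastadCNFN`). [cite: Hastad2001, §6.1] -/
abbrev MG := ((G.dartGame2 C Z.W hd).pow T).hGame k (hypM Z G C hd hn hall T hT) hk

/-- Codes of Bob's vertices of the block game. [folklore] -/
def cVM (w : Fin (nBlocks k) → NProd (Fin Z.n × Fin Z.d) T) : ℕ := codeFn (cV1 Z T) (Z.NV1 T) w

/-- Codes of edges of the block game: `ℓ + L (vs + NVM · e)`. [folklore] -/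
def cEM (e : Fin (nBlocks k) × (Fin (nBlocks k) → NProd (Fin Z.n × Fin Z.d) T) × NProd ((Fin Z.n × Fin Z.d) × Fin 2) T) : ℕ :=
  e.1.val + nBlocks k * (cVM Z T k e.2.1 + Z.NVM T (nBlocks k) * cE1 Z T e.2.2)

/-- Codes of Alice's vertices of the block game: `ℓ + L (vs + NVM · u)`. [folklore] -/
def cUM (u : BlockU (NProd (Fin Z.n × Fin Z.d) T) (NProd (Fin Z.n) T) (nBlocks k) (hypM Z G C hd hn hall T hT).v₀) : ℕ :=
  u.1.1.val + nBlocks k * (cVM Z T k u.1.2.1 + Z.NVM T (nBlocks k) * cU1 Z T u.1.2.2)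

/-- Codes of Bob's labels of the block game. [folklore] -/
def cBM (y : Fin (nBlocks k) → NProd (Fin (2 * Z.W) × Fin (2 * Z.W)) T) : ℕ := codeFn (cB1 Z T) (Z.NB1 T) y

/-- Codes of Alice's labels of the block game: `y + NBM · a`. [folklore] -/
def cAM (x : (Fin (nBlocks k) → NProd (Fin (2 * Z.W) × Fin (2 * Z.W)) T) × NProd (Fin (2 * Z.W)) T) : ℕ :=
  cBM Z T k x.1 + Z.NBM T (nBlocks k) * cA1 Z T x.2

variable {Z G C T k}

/-- `cV1 < NV1`. [folklore] -/
theorem cV1_lt (v : NProd (Fin Z.n × Fin Z.d) T) : cV1 Z T v < Z.NV1 T := codeNP_lt cdart_lt T v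
/-- `cE1 < NE1`. [folklore] -/
theorem cE1_lt (e : NProd ((Fin Z.n × Fin Z.d) × Fin 2) T) : cE1 Z T e < Z.NE1 T := codeNP_lt ce0_lt T e
/-- `cU1 < NU1`. [folklore] -/
theorem cU1_lt (u : NProd (Fin Z.n) T) : cU1 Z T u < Z.NU1 T := codeNP_lt (cx := fun v : Fin Z.n => v.val) (fun v => v.2) T u
/-- `cB1 < NB1`. [folklore] -/
theorem cB1_lt (b : NProd (Fin (2 * Z.W) × Fin (2 * Z.W)) T) : cB1 Z T b < Z.NB1 T := codeNP_lt cb0_lt T b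
/-- `cA1 < NA1`. [folklore] -/
theorem cA1_lt (a : NProd (Fin (2 * Z.W)) T) : cA1 Z T a < Z.NA1 T := codeNP_lt (cx := fun a : Fin (2 * Z.W) => a.val) (fun a => a.2) T a
/-- `cVM < NVM`. [folklore] -/
theorem cVM_lt (w : Fin (nBlocks k) → NProd (Fin Z.n × Fin Z.d) T) : cVM Z T k w < Z.NVM T (nBlocks k) := codeFn_lt cV1_lt w
/-- `cBM < NBM`. [folklore] -/
theorem cBM_lt (y : Fin (nBlocks k) → NProd (Fin (2 * Z.W) × Fin (2 * Z.W)) T) : cBM Z T k y < Z.NBM T (nBlocks k) := codeFn_lt cB1_lt y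

/-- `cEM < NEM`. [folklore] -/
theorem cEM_lt (e : Fin (nBlocks k) × (Fin (nBlocks k) → NProd (Fin Z.n × Fin Z.d) T) × NProd ((Fin Z.n × Fin Z.d) × Fin 2) T) :
    cEM Z T k e < Z.NEM T (nBlocks k) :=
  add_mul_lt e.1.2 (add_mul_lt' (cVM_lt _) (cE1_lt _))

/-- Decoding `cEM`. [folklore] -/
theorem cEM_decode (e : Fin (nBlocks k) × (Fin (nBlocks k) → NProd (Fin Z.n × Fin Z.d) T) × NProd ((Fin Z.n × Fin Z.d) × Fin 2) T) :
    cEM Z T k e % nBlocks k = e.1.val ∧ cEM Z T k e / nBlocks k % Z.NVM T (nBlocks k) = cVM Z T k e.2.1 ∧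
      cEM Z T k e / nBlocks k / Z.NVM T (nBlocks k) = cE1 Z T e.2.2 :=
  decode3 e.1.2 (cVM_lt _)

/-- `cEM` is injective. [folklore] -/
theorem cEM_injective : Function.Injective (cEM Z T k) := fun e e' h => by
  have h1 := cEM_decode e; have h2 := cEM_decode e'
  rw [h] at h1
  exact Prod.ext (Fin.ext (h1.1.symm.trans h2.1)) (Prod.ext (codeFn_injective cV1_lt (codeNP_injective cdart_lt cdart_injective T) (h1.2.1.symm.trans h2.2.1))
    (codeNP_injective ce0_lt ce0_injective T (h1.2.2.symm.trans h2.2.2)))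

/-- `cUM < NUM`. [folklore] -/
theorem cUM_lt (u : BlockU (NProd (Fin Z.n × Fin Z.d) T) (NProd (Fin Z.n) T) (nBlocks k) (hypM Z G C hd hn hall T hT).v₀) :
    cUM Z G C hd hn hall T hT k u < Z.NUM T (nBlocks k) :=
  add_mul_lt u.1.1.2 (add_mul_lt' (cVM_lt _) (cU1_lt _))

/-- `cUM` is injective. [folklore] -/
theorem cUM_injective : Function.Injective (cUM Z G C hd hn hall T hT k) := fun u u' h => by
  have h1 := decode3 (A := Z.NVM T (nBlocks k)) (b := cU1 Z T u.1.2.2) u.1.1.2 (cVM_lt u.1.2.1)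
  have h2 := decode3 (A := Z.NVM T (nBlocks k)) (b := cU1 Z T u'.1.2.2) u'.1.1.2 (cVM_lt u'.1.2.1)
  unfold cUM at h
  rw [h] at h1
  refine Subtype.ext (Prod.ext (Fin.ext (h1.1.symm.trans h2.1)) (Prod.ext
    (codeFn_injective cV1_lt (codeNP_injective cdart_lt cdart_injective T) (h1.2.1.symm.trans h2.2.1))
    (codeNP_injective (cx := fun v : Fin Z.n => v.val) (fun v => v.2) Fin.val_injective T (h1.2.2.symm.trans h2.2.2))))

/-- `cAM < NAM`. [folklore] -/
theorem cAM_lt (x : (Fin (nBlocks k) → NProd (Fin (2 * Z.W) × Fin (2 * Z.W)) T) × NProd (Fin (2 * Z.W)) T) : cAM Z T k x < Z.NAM T (nBlocks k) :=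
  add_mul_lt' (cBM_lt _) (cA1_lt _)

/-- `cBM` is injective. [folklore] -/
theorem cBM_injective : Function.Injective (cBM Z T k) := codeFn_injective cB1_lt (codeNP_injective cb0_lt cb0_injective T)

/-- `cAM` is injective. [folklore] -/
theorem cAM_injective : Function.Injective (cAM Z T k) := fun x x' h => by
  unfold cAM at h
  have h1 := (decode3 (L := 1) (ℓ := 0) (b := cA1 Z T x.2) Nat.one_pos (cBM_lt x.1))
  have h2 := (decode3 (L := 1) (ℓ := 0) (b := cA1 Z T x'.2) Nat.one_pos (cBM_lt x'.1))
  simp only [zero_add, one_mul, Nat.div_one] at h1 h2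
  rw [h] at h1
  exact Prod.ext (cBM_injective (h1.2.1.symm.trans h2.2.1))
    (codeNP_injective (cx := fun a : Fin (2 * Z.W) => a.val) (fun a => a.2) Fin.val_injective T (h1.2.2.symm.trans h2.2.2))

/-! #### Cardinalities and the enumerations -/

/-- `|E_M| = NEM`. [folklore] -/
theorem card_EM : Fintype.card (Fin (nBlocks k) × (Fin (nBlocks k) → NProd (Fin Z.n × Fin Z.d) T) × NProd ((Fin Z.n × Fin Z.d) × Fin 2) T) =
    Z.NEM T (nBlocks k) := by
  simp only [Fintype.card_prod, Fintype.card_fin, Fintype.card_fun, card_NProd]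
  unfold NLazy.NEM NLazy.NVM NLazy.NV1 NLazy.NE1 NLazy.ND
  ring

/-- `|β_M| = NBM`. [folklore] -/
theorem card_BM : Fintype.card (Fin (nBlocks k) → NProd (Fin (2 * Z.W) × Fin (2 * Z.W)) T) = Z.NBM T (nBlocks k) := by
  simp only [Fintype.card_prod, Fintype.card_fin, Fintype.card_fun, card_NProd]; rfl

/-- `|α_M| = NAM`. [folklore] -/
theorem card_AM : Fintype.card ((Fin (nBlocks k) → NProd (Fin (2 * Z.W) × Fin (2 * Z.W)) T) × NProd (Fin (2 * Z.W)) T) = Z.NAM T (nBlocks k) := by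
  simp only [Fintype.card_prod, Fintype.card_fin, Fintype.card_fun, card_NProd]; rfl

/-- An injective code with the right range is an enumeration. [folklore] -/
def finCode {X : Type} [Fintype X] (f : X → ℕ) (N : ℕ) (hlt : ∀ x, f x < N) (hinj : Function.Injective f) (hcard : Fintype.card X = N) : X ≃ Fin N :=
  Equiv.ofBijective (fun x => ⟨f x, hlt x⟩)
    ((Fintype.bijective_iff_injective_and_card _).2 ⟨fun x y h => hinj (Fin.mk.inj_iff.1 h), by rw [hcard, Fintype.card_fin]⟩)

/-- The value of the enumeration is the code. [folklore] -/
@[simp] theorem finCode_val {X : Type} [Fintype X] (f : X → ℕ) (N : ℕ) (hlt : ∀ x, f x < N) (hinj : Function.Injective f)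
    (hcard : Fintype.card X = N) (x : X) : (finCode f N hlt hinj hcard x).val = f x := rfl

variable (Z G C T k)

/-- The enumeration of the edges of the block game. [folklore] -/
def eEM : (Fin (nBlocks k) × (Fin (nBlocks k) → NProd (Fin Z.n × Fin Z.d) T) × NProd ((Fin Z.n × Fin Z.d) × Fin 2) T) ≃ Fin (Z.NEM T (nBlocks k)) :=
  finCode (cEM Z T k) _ cEM_lt cEM_injective card_EM

/-- The enumeration of Bob's labels of the block game. [folklore] -/
def eBM : (Fin (nBlocks k) → NProd (Fin (2 * Z.W) × Fin (2 * Z.W)) T) ≃ Fin (Z.NBM T (nBlocks k)) :=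
  finCode (cBM Z T k) _ cBM_lt cBM_injective card_BM

/-- The enumeration of Alice's labels of the block game. [folklore] -/
def eAM : ((Fin (nBlocks k) → NProd (Fin (2 * Z.W) × Fin (2 * Z.W)) T) × NProd (Fin (2 * Z.W)) T) ≃ Fin (Z.NAM T (nBlocks k)) :=
  finCode (cAM Z T k) _ cAM_lt cAM_injective card_AM

/-! #### The closed-form numbering and the CNF data -/

/-- **The numbering of Alice's folded table entries**: `cU u · 2^{NAM} + ⟦f⟧`. [folklore] -/
def nAM (u : BlockU (NProd (Fin Z.n × Fin Z.d) T) (NProd (Fin Z.n) T) (nBlocks k) (hypM Z G C hd hn hall T hT).v₀)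
    (f : (Fin (nBlocks k) → NProd (Fin (2 * Z.W) × Fin (2 * Z.W)) T) × NProd (Fin (2 * Z.W)) T → Bool) : ℕ :=
  cUM Z G C hd hn hall T hT k u * 2 ^ Z.NAM T (nBlocks k) + toNat (fun i : Fin (Z.NAM T (nBlocks k)) => f ((eAM Z T k).symm i))

/-- **The numbering of Bob's folded table entries**: `NUM 2^{NAM} + cV w · 2^{NBM} + ⟦g⟧`. [folklore] -/
def nBM (w : Fin (nBlocks k) → NProd (Fin Z.n × Fin Z.d) T) (gg : (MG Z G C hd hn hall T hT k hk).Lab w → Bool) : ℕ :=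
  Z.NUM T (nBlocks k) * 2 ^ Z.NAM T (nBlocks k) + cVM Z T k w * 2 ^ Z.NBM T (nBlocks k) +
    toNat (fun i : Fin (Z.NBM T (nBlocks k)) => if h : (MG Z G C hd hn hall T hT k hk).Adm w ((eBM Z T k).symm i) then gg ⟨(eBM Z T k).symm i, h⟩ else false)

/-- **The CNF data of the machine**: `hastadDataN` with the closed-form numbering. [cite: Hastad2001, §6.1] -/
def DM : (MG Z G C hd hn hall T hT k hk).CNFData :=
  ((G.dartGame2 C Z.W hd).pow T).hastadDataN k (hypM Z G C hd hn hall T hT) hk (nAM Z G C hd hn hall T hT k) (nBM Z G C hd hn hall T hT k hk)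

/-- The CNF of the machine's data is `hastadCNFN`. [cite: Hastad2001, Thm 6.5] -/
theorem hCNF_DM : (DM Z G C hd hn hall T hT k hk).hCNF =
    ((G.dartGame2 C Z.W hd).pow T).hastadCNFN k (hypM Z G C hd hn hall T hT) (nAM Z G C hd hn hall T hT k) (nBM Z G C hd hn hall T hT k hk) := rfl

/-! #### The mirror equations of the block game -/

variable {Z G C T k}
variable (hM : Mirror (Z := Z) G C)

/-- The code of the blank vertex `v₀` is `0`. [folklore] -/
theorem cV1_v₀ : cV1 Z T (hypM Z G C hd hn hall T hT).v₀ = 0 :=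
  codeNP_constNProd (cx := cdart Z) (by unfold cdart; simp) T

/-- The code of Alice's base label `a₀` is `0`. [folklore] -/
theorem cA1_a₀ : cA1 Z T (hypM Z G C hd hn hall T hT).a₀ = 0 :=
  codeNP_constNProd (cx := fun a : Fin (2 * Z.W) => a.val) rfl T

include hM in
/-- The code of the blank label `b₀ = lab0 v₀` is `b0`. [folklore] -/
theorem cB1_b₀ : cB1 Z T ((hypM Z G C hd hn hall T hT).lab0 (hypM Z G C hd hn hall T hT).v₀) = Z.b0 T := by
  unfold NLazy.b0
  rw [← cV1_v₀ hd hn hall hT, lab0T_eq hM hall T]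
  rfl

/-- **`srcM` mirrors `src` of the block game.** [cite: Khot2002, §3] -/
theorem srcM_eq (e : Fin (nBlocks k) × (Fin (nBlocks k) → NProd (Fin Z.n × Fin Z.d) T) × NProd ((Fin Z.n × Fin Z.d) × Fin 2) T) :
    Z.srcM T (nBlocks k) (cEM Z T k e) = cVM Z T k ((MG Z G C hd hn hall T hT k hk).src e) := by
  obtain ⟨h1, h2, h3⟩ := cEM_decode e
  unfold NLazy.srcM
  rw [h1, h2, h3, src1_eq (G := G) hd T e.2.2]
  show _ = cVM Z T k (Function.update e.2.1 e.1 (((G.dartGame2 C Z.W hd).pow T).src e.2.2))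
  unfold cVM
  rw [codeFn_update cV1_lt]

include hM in
/-- **`dstM` mirrors `dst` of the block game.** [cite: Khot2002, §3] -/
theorem dstM_eq (e : Fin (nBlocks k) × (Fin (nBlocks k) → NProd (Fin Z.n × Fin Z.d) T) × NProd ((Fin Z.n × Fin Z.d) × Fin 2) T) :
    Z.dstM T (nBlocks k) (cEM Z T k e) = cUM Z G C hd hn hall T hT k ((MG Z G C hd hn hall T hT k hk).dst e) := by
  obtain ⟨h1, h2, h3⟩ := cEM_decode e
  unfold NLazy.dstM cUM
  rw [h1, h2, h3, dst1_eq hd hM T e.2.2]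
  simp only [block_dst_val]
  unfold cVM
  rw [codeFn_update cV1_lt, cV1_v₀]

include hM in
/-- **`projM` mirrors `proj` of the block game.** [cite: Khot2002, §3] -/
theorem projM_eq (e : Fin (nBlocks k) × (Fin (nBlocks k) → NProd (Fin Z.n × Fin Z.d) T) × NProd ((Fin Z.n × Fin Z.d) × Fin 2) T)
    (y : Fin (nBlocks k) → NProd (Fin (2 * Z.W) × Fin (2 * Z.W)) T) :
    Z.projM T (nBlocks k) (cEM Z T k e) (cBM Z T k y) = ((MG Z G C hd hn hall T hT k hk).proj e y).elim 0 fun a => (eAM Z T k a).val + 1 := by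
  obtain ⟨h1, h2, h3⟩ := cEM_decode e
  unfold NLazy.projM
  rw [h1, h3, show dg (Z.NB1 T) (cBM Z T k y) e.1.val = cB1 Z T (y e.1) from dg_codeFn cB1_lt y e.1, proj1_eq hd hM T e.2.2 (y e.1)]
  simp only [block_proj]
  cases ((G.dartGame2 C Z.W hd).pow T).proj e.2.2 (y e.1) with
  | none => rfl
  | some a =>
    simp only [Option.elim_some, Nat.succ_ne_zero, if_false, Option.map_some, Nat.add_sub_cancel, finCode_val, eAM]
    unfold cAM cBM
    rw [codeFn_update cB1_lt, cB1_b₀ hd hn hall hT hM]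

include hM in
/-- **`xAM` mirrors Alice's base point.** [folklore] -/
theorem xAM_eq (u : BlockU (NProd (Fin Z.n × Fin Z.d) T) (NProd (Fin Z.n) T) (nBlocks k) (hypM Z G C hd hn hall T hT).v₀) :
    Z.xAM T (nBlocks k) (cUM Z G C hd hn hall T hT k u) = (eAM Z T k ((DM Z G C hd hn hall T hT k hk).xA u)).val := by
  rw [eAM, finCode_val]
  show _ = cAM Z T k (fun _ => (hypM Z G C hd hn hall T hT).lab0 (hypM Z G C hd hn hall T hT).v₀, (hypM Z G C hd hn hall T hT).a₀)
  unfold cAM cBM NLazy.xAM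
  rw [cA1_a₀, mul_zero, add_zero, codeFn_const, cB1_b₀ hd hn hall hT hM]

include hM in
/-- **`yBM` mirrors Bob's base point.** [folklore] -/
theorem yBM_eq (w : Fin (nBlocks k) → NProd (Fin Z.n × Fin Z.d) T) :
    Z.yBM T (nBlocks k) (cVM Z T k w) = (eBM Z T k ((DM Z G C hd hn hall T hT k hk).yB w).1).val := by
  rw [eBM, finCode_val]
  show _ = cBM Z T k (fun ℓ => (hypM Z G C hd hn hall T hT).lab0 (w ℓ))
  unfold cBM NLazy.yBM
  refine (codeFn_eq_sumBelow _ _ fun ℓ => ?_).symm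
  rw [show dg (Z.NV1 T) (cVM Z T k w) ℓ = cV1 Z T (w ℓ) from dg_codeFn cV1_lt w ℓ, lab0T_eq hM hall T]
  rfl

/-- `K⋆ = NBM`. [folklore] -/
theorem Kstar_eq : (DM Z G C hd hn hall T hT k hk).Kstar = Z.NBM T (nBlocks k) := card_BM

/-- **The coding of the block game.** [cite: Hastad2001, §6.1] -/
def codingM : Coding (MG Z G C hd hn hall T hT k hk) (DM Z G C hd hn hall T hT k hk) (Z.gM T (nBlocks k) k) where
  eE := eEM Z T k
  eB := eBM Z T k
  eA := eAM Z T k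
  cV := cVM Z T k
  cU := cUM Z G C hd hn hall T hT k
  cU_lt := cUM_lt hd hn hall hT
  cV_inj := codeFn_injective cV1_lt (codeNP_injective cdart_lt cdart_injective T)
  cU_inj := cUM_injective hd hn hall hT
  src_eq := srcM_eq hd hn hall hT hk
  dst_eq := dstM_eq hd hn hall hT hk hM
  proj_eq := projM_eq hd hn hall hT hk hM
  xA_eq := xAM_eq hd hn hall hT hk hM
  yB_eq := yBM_eq hd hn hall hT hk hM
  p_eq := rfl
  q_eq := rfl
  K_eq := Kstar_eq hd hn hall hT hk
  nA_eq := fun _ _ => rfl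
  nB_eq := fun _ _ => rfl

include hM in
/-- **The closed-form numbering is good.** [cite: Hastad2001, §6.1] -/
theorem goodNumbering_M : (DM Z G C hd hn hall T hT k hk).GoodNumbering := (codingM hd hn hall hT hk hM).goodNumbering

include hM in
/-- **The numeric CNF of the block game is a permutation of `hastadCNFN`.** [cite: Hastad2001, §6.1 (proof of Thm 6.5)] -/
theorem perm_numCNF_M : (Z.gM T (nBlocks k) k).numCNF.Perm
    (((G.dartGame2 C Z.W hd).pow T).hastadCNFN k (hypM Z G C hd hn hall T hT) (nAM Z G C hd hn hall T hT k) (nBM Z G C hd hn hall T hT k hk)) :=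
  (codingM hd hn hall hT hk hM).perm_numCNF

/-- **The variables of the CNF are below `NUM · 2^{NAM} + NVM · 2^{NBM}`.** [folklore] -/
theorem fst_lt_of_mem_hCNF {c : Clause ℕ} (hc : c ∈ (DM Z G C hd hn hall T hT k hk).hCNF) {l : Literal ℕ} (hl : l ∈ c) :
    l.1 < Z.NUM T (nBlocks k) * 2 ^ Z.NAM T (nBlocks k) + Z.NVM T (nBlocks k) * 2 ^ Z.NBM T (nBlocks k) := by
  unfold CNFData.hCNF at hc
  rw [List.mem_flatMap] at hc
  obtain ⟨t, -, hct⟩ := hc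
  rw [List.mem_replicate] at hct
  obtain ⟨-, rfl⟩ := hct
  have hA : ∀ u f, (DM Z G C hd hn hall T hT k hk).nA u f < Z.NUM T (nBlocks k) * 2 ^ Z.NAM T (nBlocks k) := by
    intro u f
    show nAM Z G C hd hn hall T hT k u f < _
    unfold nAM
    have h1 := cUM_lt hd hn hall hT u
    have h2 := toNat_lt (fun i : Fin (Z.NAM T (nBlocks k)) => f ((eAM Z T k).symm i))
    nlinarith
  have hB : ∀ w gg, (DM Z G C hd hn hall T hT k hk).nB w gg < Z.NUM T (nBlocks k) * 2 ^ Z.NAM T (nBlocks k) + Z.NVM T (nBlocks k) * 2 ^ Z.NBM T (nBlocks k) := by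
    intro w gg
    show nBM Z G C hd hn hall T hT k hk w gg < _
    unfold nBM
    have h1 := cVM_lt (k := k) w
    have h2 := toNat_lt (fun i : Fin (Z.NBM T (nBlocks k)) =>
      if h : (MG Z G C hd hn hall T hT k hk).Adm w ((eBM Z T k).symm i) then gg ⟨(eBM Z T k).symm i, h⟩ else false)
    nlinarith
  unfold CNFData.clauseT at hl
  simp only [List.mem_cons, List.not_mem_nil, or_false] at hl
  rcases hl with rfl | rfl | rfl
  · rw [CNFData.litA_fst]; exact (hA _ _).trans_le (Nat.le_add_right _ _)
  · rw [CNFData.litB_fst]; exact hB _ _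
  · rw [CNFData.litB_fst]; exact hB _ _

end Block

end Typed

end HastadPV

end Literature.Computability.Complexity

end
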